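import Mathlib

/-!
# Landing transversality in the linear outer class (solo-blind, s74)

In the linear-response outer class `q''' = -S` of the steady inverse-cascade design (paper §24.59,
kernel `SoloBlindQuarticLandingModel`), a packet lifts off cubically at `x₀` and lands
quartically at the contact leaf `X` (`S X = 0`) iff the three moments
`M_k = ∫_{x₀}^{X} (X - s)^k S(s) ds`, `k = 0, 1, 2`, vanish.  Unfold `S` by a height `h`
(the viscous dial `K₀`) and a shape dial `θ` with `∂S/∂θ = T`.  At a landing zero
(`M₀ = M₁ = 0`, `S X = 0`) the fundamental theorem of calculus gives the Jacobian
`∂(M₀,M₁,M₂)/∂(x₀,h,θ)` the rows `(-a w^k, w^(k+1)/(k+1), τ_k)`, `k = 0,1,2`, where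
`a = S x₀`, `w = X - x₀`, `τ_k = ∫_{x₀}^{X} (X-s)^k T(s) ds` (the `X`-motion terms drop because
they are multiples of `M₀`, `M₁`, `S X`).  This file records the exact algebra of that matrix:

* `landingJacobian_det`: its determinant is `(a w²/6) (w² τ₀ - 4 w τ₁ + 3 τ₂)`, i.e.
  `(a w²/6) ∫ (3r - w)(r - w) T(X - r) dr` — transversality ⇔ strict lift-off `S x₀ ≠ 0`
  and a non-degenerate tilt; a pure height shift (`T = 1`) is degenerate, as it must be;
* `landingJacobian_det_tilt`: for the affine tilt `T s = s` the determinant is `a w⁶/72`;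
* `landingJacobian_det_model`: at the algebraic landing of `SoloBlindQuarticLandingModel`
  (`a = S x₀ = -343/180`, `w = 7√6/6`) it equals `-40353607/2799360 ≠ 0`.

Float cross-check (work/carrier81/landing_jac.py): finite-difference Jacobian agrees to 1e-6,
`det = -14.415297`.
-/

namespace Summit.AnomalousDissipation.AnomalousDissipation.Theorems

open Matrix

/-- The landing Jacobian of the linear outer class with lift-off value `a = S x₀`, live width `w`
and tilt moments `τ₀ τ₁ τ₂`. -/
noncomputable def landingJacobian (a w τ₀ τ₁ τ₂ : ℝ) : Matrix (Fin 3) (Fin 3) ℝ :=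
  !![-a, w, τ₀; -a * w, w ^ 2 / 2, τ₁; -a * w ^ 2, w ^ 3 / 3, τ₂]

/-- Determinant of the landing Jacobian: `(a w²/6)(w² τ₀ - 4 w τ₁ + 3 τ₂)`. -/
theorem landingJacobian_det (a w τ₀ τ₁ τ₂ : ℝ) :
    (landingJacobian a w τ₀ τ₁ τ₂).det = a * w ^ 2 / 6 * (w ^ 2 * τ₀ - 4 * w * τ₁ + 3 * τ₂) := by
  unfold landingJacobian
  rw [Matrix.det_fin_three]
  simp [Matrix.of_apply, Matrix.cons_val', Matrix.cons_val_zero, Matrix.cons_val_one]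
  ring

/-- A pure height shift (`T = 1`, `τ_k = w^(k+1)/(k+1)`) is a degenerate unfolding direction. -/
theorem landingJacobian_det_height (a w : ℝ) :
    (landingJacobian a w w (w ^ 2 / 2) (w ^ 3 / 3)).det = 0 := by
  rw [landingJacobian_det]; ring

/-- For the affine tilt `T s = s` about the origin, `τ_k = X w^(k+1)/(k+1) - w^(k+2)/(k+2)` and the
determinant is `a w⁶ / 72`, independent of the contact position `X`. -/
theorem landingJacobian_det_tilt (a w X : ℝ) :
    (landingJacobian a w (X * w - w ^ 2 / 2) (X * w ^ 2 / 2 - w ^ 3 / 3)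
      (X * w ^ 3 / 3 - w ^ 4 / 4)).det = a * w ^ 6 / 72 := by
  rw [landingJacobian_det]; ring

/-- Transversality criterion in the tilt family: the landing zero is transversal iff the lift-off is
strict (`a = S x₀ ≠ 0`) and the live interval is non-degenerate (`w ≠ 0`). -/
theorem landingJacobian_det_tilt_ne_zero {a w : ℝ} (X : ℝ) (ha : a ≠ 0) (hw : w ≠ 0) :
    (landingJacobian a w (X * w - w ^ 2 / 2) (X * w ^ 2 / 2 - w ^ 3 / 3)
      (X * w ^ 3 / 3 - w ^ 4 / 4)).det ≠ 0 := by
  rw [landingJacobian_det_tilt]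
  have h6 : a * w ^ 6 ≠ 0 := mul_ne_zero ha (pow_ne_zero 6 hw)
  exact div_ne_zero h6 (by norm_num)

/-- The lift-off value of the algebraic model ridge of `SoloBlindQuarticLandingModel`,
`S t = 31/60 - (t² - 1)² - (4√6/45) t` at `x₀ = -(2/3)√6`, is `-343/180`. -/
theorem model_liftoff_value :
    (31 / 60 : ℝ) - ((-(2 / 3) * Real.sqrt 6) ^ 2 - 1) ^ 2
      - 4 * Real.sqrt 6 / 45 * (-(2 / 3) * Real.sqrt 6) = -343 / 180 := by
  have h2 : Real.sqrt 6 ^ 2 = 6 := Real.sq_sqrt (by norm_num)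
  linear_combination (-16 / 81 * Real.sqrt 6 ^ 2 - 32 / 135) * h2

/-- At the algebraic landing of `SoloBlindQuarticLandingModel` (`a = -343/180`, live width
`w = X - x₀ = √6/2 + (2/3)√6 = 7√6/6`) the landing Jacobian in the (lift-off, height, tilt)
unfolding has determinant `-40353607/2799360 ≈ -14.4153`: the quartic landing is a transversal
zero, for any contact position `X`. -/
theorem landingJacobian_det_model (w X : ℝ) (hw : w = 7 * Real.sqrt 6 / 6) :
    (landingJacobian (-343 / 180) w (X * w - w ^ 2 / 2) (X * w ^ 2 / 2 - w ^ 3 / 3)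
      (X * w ^ 3 / 3 - w ^ 4 / 4)).det = -40353607 / 2799360 := by
  rw [landingJacobian_det_tilt, hw]
  have h2 : Real.sqrt 6 ^ 2 = 6 := Real.sq_sqrt (by norm_num)
  have h6 : Real.sqrt 6 ^ 6 = 216 := by
    calc Real.sqrt 6 ^ 6 = (Real.sqrt 6 ^ 2) ^ 3 := by ring
      _ = 216 := by rw [h2]; norm_num
  rw [div_pow, mul_pow, h6]
  norm_num

/-- The live width of the algebraic model: `√6/2 - (-(2/3)√6) = 7√6/6`. -/
theorem model_live_width : Real.sqrt 6 / 2 - (-(2 / 3) * Real.sqrt 6) = 7 * Real.sqrt 6 / 6 := by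
  ring

end Summit.AnomalousDissipation.AnomalousDissipation.Theorems
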